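import Summits.CriticalPhenomena.PercolationContinuityZ3.Theorems.Transplant.KNCellsStepsDefs
import HarnessLib

/-!
# F8 (generic), part 4d — the corridor input of (37) with anchors: from (32) and the PATTERN-PINNED Lemma 12 to the summed bound
# `Σ_{a'} μ_{a'}(Reach_{a'}ᶜ ∩ Dev a') ≤ ε'' + δ` (design HOME/prim-bschramm-p2-g2/F8-DESIGN.md §5, input (I1))

builds on p205010 (kernel theorem, internal audit signed; external expert review pending) — nothing in this file uses p205010.
Lane `prim-bschramm`, seat `prim-bschramm-p2` (task F8 Steps-over-cells); helper file (`--supports stmt-CriticalPhenomena-4575`).  Continuation of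
`KNCellsStepsDefs` (`Wfull`, `Reach`, `Dev`, `baseF`).

With anchors the departure anchor `a'(ω)` of the examined vertex is read off the fresh pattern `P = ω ∩ B` of the edges `B = baseF \ F` of
`E_i ∪ E_{w,v}`; KN's single application of Lemma 12 under `μ` (`reach_bound`, Steps p. 30) becomes one application PER PATTERN `P`, under `μ`
pinned on `B` along `P`, at the anchor `a'(P)`, and only for the GOOD patterns — those in which the root is joined to `M_v` inside `E_i ∪ E_{w,v}`
(a decided event given `P`; by (32) the good patterns have mass `> 1 - δ`).  This file performs that bookkeeping:
* `patAnchor`, `GoodPat` (the pattern's anchor; the root reaches `M_v` inside `E_i ∪ E_{w,v}` in the configuration `ξ ∪ P`);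
* `real_localCylinder_eq` — the cylinders of `B` have the same mass under every `μ_{a'}` and under `P_p` (fresh edges);
* `real_good_ge` — `Σ_{good P} P_p([P]_B) ≥ P_{W₀}(root ↔ M_v)` (on `[ξ]_F ∩ [P]_B ∩ lattice-only`, the event is decided by `ξ ∪ P`);
* **`sum_real_Reach_compl_inter_Dev_le`** — if `1 - δ < P_{W₀}(root ↔ M_v)` ((32)) and, for every good `P ⊆ B`,
  `1 - ε'' < P_{pinW μ_{a'(P)} B P}(Reach_{a'(P)})` (Lemma 12 over cells, pattern-pinned — hypothesis `hcorr`), then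
  `Σ_{a' ∈ anchSet} μ_{a'}(Reach_{a'}ᶜ ∩ Dev a') ≤ ε'' + δ` — the hypothesis `hreach` of `fail_bound` (part 4c).
[cite: KozmaNitzan2024, §4 p. 30 (Step IV, first claim), p. 31 ((37)) — the ℤ^d model] [cite: GrimmettPercolation1999, §7.2]
-/

noncomputable section

open MeasureTheory ProbabilityTheory
open scoped ENNReal Classical

namespace Summit.CriticalPhenomena.PercolationContinuityZ3.Theorems

namespace Transplant

namespace KNCells

open Literature.Probability.Percolation Literature.Probability.LatticeModels SimpleGraph GadgetSystem ProbeHistory HSiteScheme Contour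

variable {V : Type*} [DecidableEq V] [Countable V]

namespace KSchA

variable {A : Type*} {G : SimpleGraph V} [G.LocallyFinite] (S : KSchA V A)

variable (G) in
/-- The fresh edges of `E_i ∪ E_{w,v}` (`B = baseF \ F`): the coordinates whose pattern decides the departure anchor. [folklore] -/
abbrev Bfr (h : ProbeHistory V) (e : Site 2 × MDir) (a : A) : Finset (Sym2 V) := S.baseF G h e a \ S.F G h

variable (G) in
/-- The departure anchor of a pattern `P` of the fresh edges of `E_i ∪ E_{w,v}` (the recorded pattern `ξ` being fixed). [folklore] -/
def patAnchor (h : ProbeHistory V) (e : Site 2 × MDir) (a : A) (P : Finset (Sym2 V)) : A := S.Γ.anchor a (tgt e) (S.ξ G h ∪ P)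

variable (G) in
/-- The event "the root is joined to `M_v` inside `E_i ∪ E_{w,v}`" (the event of (32), inside form). [cite: KozmaNitzan2024, §4 p. 28 ((32))] -/
def ReachM (h : ProbeHistory V) (e : Site 2 × MDir) (a : A) : Set (BondConfig V) :=
  ⋃ t ∈ (↑(S.Γ.M a (tgt e)) : Set V), openConnIn (↑(S.Vx G h ∪ S.Γ.Ewv a e.1 e.2) : Set V) S.Γ.root t

variable (G) in
/-- **Good patterns**: the configuration `ξ ∪ P` joins the root to `M_v` inside `E_i ∪ E_{w,v}`. [folklore] -/
def GoodPat (h : ProbeHistory V) (e : Site 2 × MDir) (a : A) (P : Finset (Sym2 V)) : Prop :=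
  ((↑(S.ξ G h) : Set (Sym2 V)) ∪ ↑P) ∈ S.ReachM G h e a

variable {S}
variable {h : ProbeHistory V} {e : Site 2 × MDir} (hV : S.Valid G h e) {a : A} {du : MDir} {FD : FaceData V A} (hSt : StepsGeom S.Γ FD)

omit [Countable V] in
/-- On a pattern `P` of the fresh edges, the observation of the envelope restricted to them is `P`, so the chosen anchor is `patAnchor P`. [folklore] -/
theorem depA_obs_eq_patAnchor {P : Finset (Sym2 V)} (hP : P ⊆ S.Bfr G h e a) {ω : BondConfig V}
    (hω : ω ∈ localCylinder (↑(S.Bfr G h e a) : Set (Sym2 V)) ↑P) :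
    S.depA G h e a (obs ω (S.env G h e a)) = S.patAnchor G h e a P := by
  unfold depA patAnchor seen
  congr 1
  ext x
  simp only [Finset.mem_union, Finset.mem_inter, mem_obs_iff, Finset.mem_sdiff]
  constructor
  · rintro (hx | ⟨⟨hxe, hxω⟩, hxB, hxF⟩)
    · exact Or.inl hx
    · right
      have := hω x (Finset.mem_coe.2 (Finset.mem_sdiff.2 ⟨hxB, hxF⟩))
      exact Finset.mem_coe.1 (this.1 hxω)
  · rintro (hx | hx)
    · exact Or.inl hx
    · right
      have hxB := hP hx
      obtain ⟨hxB', hxF⟩ := Finset.mem_sdiff.1 hxB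
      have hxe : x ∈ S.env G h e a := S.revealOf_subset_env h e a (obs ω (S.env G h e a)) (S.baseF_sdiff_subset_revealOf h e a _ hxB)
      have := hω x (Finset.mem_coe.2 hxB)
      exact ⟨⟨hxe, this.2 (Finset.mem_coe.2 hx)⟩, hxB', hxF⟩

omit [Countable V] in
/-- `[P]_B ⊆ Dev (patAnchor P)`. [folklore] -/
theorem localCylinder_subset_Dev {P : Finset (Sym2 V)} (hP : P ⊆ S.Bfr G h e a) :
    localCylinder (↑(S.Bfr G h e a) : Set (Sym2 V)) ↑P ⊆ S.Dev G h e a (S.patAnchor G h e a P) :=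
  fun _ hω => depA_obs_eq_patAnchor hP hω

omit [Countable V] in
include hSt in
/-- **The cylinders of the fresh edges have the same mass under `μ_{a'}` as under `P_p`** (`a'` admissible). [folklore] -/
theorem real_localCylinder_eq {a' : A} (ha' : a' ∈ S.Γ.anchSet a (tgt e)) (P : Finset (Sym2 V)) :
    (prodBernoulli (S.Wfull G h e a a' du)).real (localCylinder (↑(S.Bfr G h e a) : Set (Sym2 V)) ↑P) =
      (bondPercolation G S.p).real (localCylinder (↑(S.Bfr G h e a) : Set (Sym2 V)) ↑P) := by
  rw [← KNLevels.prodBernoulli_lattW]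
  refine prodBernoulli_real_eq_of_determinedBy _ _ (fun x hx => ?_) (determinedBy_localCylinder _ _)
    (measurableSet_localCylinder (S.Bfr G h e a).finite_toSet.countable _)
  obtain ⟨hx1, hx2⟩ := Finset.mem_sdiff.1 (Finset.mem_coe.1 hx)
  have hxS : x ∈ wireSet (↑(S.Sx G h e a a' du) : Set V) :=
    coe_Fp_subset_wireSet hSt h e ha' du (Nat.zero_le _) (Finset.mem_coe.2 (baseF_subset_Fp h e a a' du 0 hx1))
  unfold Wfull
  rw [restrW_apply_of_mem _ hxS, pinW_apply_of_not_mem _ _ (fun h' => hx2 (Finset.mem_coe.1 h'))]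

include hV in
/-- **The good patterns carry at least the mass of (32)**: `P_{W₀}(root ↔ M_v) ≤ Σ_{good P ⊆ B} P_p([P]_B)` — under the pinned weighting the
recorded pattern holds a.s. and no non-edge is open, so on `[P]_B` the event is decided by `ξ ∪ P`. [cite: KozmaNitzan2024, §4 p. 28 ((32))] -/
theorem real_W₀_le_sum_good :
    (prodBernoulli (S.W₀ G h e a)).real (⋃ t ∈ S.Γ.M a (tgt e), openConn S.Γ.root t) ≤
      ∑ P ∈ (S.Bfr G h e a).powerset.filter (fun P => S.GoodPat G h e a P),
        (bondPercolation G S.p).real (localCylinder (↑(S.Bfr G h e a) : Set (Sym2 V)) ↑P) := by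
  set B := S.Bfr G h e a with hB
  set μ₀ := prodBernoulli (pinW (KNLevels.lattW G S.p) ↑(S.F G h) ↑(S.ξ G h)) with hμ₀
  set D := S.Vx G h ∪ S.Γ.Ewv a e.1 e.2 with hD
  have h0 : S.Γ.root ∈ (↑D : Set V) := Finset.mem_coe.2 (Finset.mem_union_left _ hV.root_mem)
  -- `P_{W₀}(root ↔ M_v) = μ₀(ReachM)`
  have e1 : (prodBernoulli (S.W₀ G h e a)).real (⋃ t ∈ S.Γ.M a (tgt e), openConn S.Γ.root t) = μ₀.real (S.ReachM G h e a) := by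
    rw [W₀, ← Finset.set_biUnion_coe, prodBernoulli_restrW_real_biUnion_openConn _ _ h0]; rfl
  rw [e1]
  -- a.s. under `μ₀`: the recorded pattern on `F`, no non-edge open
  have hae1 : ∀ᵐ ω ∂μ₀, ω ∈ localCylinder (↑(S.F G h) : Set (Sym2 V)) ↑(S.ξ G h) :=
    prodBernoulli_pinW_ae_localCylinder _ (S.F G h).finite_toSet.countable _
  have hae2 : ∀ᵐ ω ∂μ₀, ∀ x ∈ {x : Sym2 V | x ∉ G.edgeSet}, x ∉ ω := by
    refine prodBernoulli_ae_forall_notMem _ (Set.to_countable _) fun x hx => ?_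
    have hxF : x ∉ (↑(S.F G h) : Set (Sym2 V)) := fun h' => hx (by
      have := Finset.mem_coe.1 h'; rw [hV.F_eq, mem_edgesIn_iff] at this; exact this.1)
    rw [pinW_apply_of_not_mem _ _ hxF, KNLevels.lattW_apply, if_neg hx]
  -- on these, `ReachM` holds iff the pattern of `B` is good
  have hkey : ∀ ω, ω ∈ localCylinder (↑(S.F G h) : Set (Sym2 V)) ↑(S.ξ G h) → (∀ x ∈ {x : Sym2 V | x ∉ G.edgeSet}, x ∉ ω) →
      ω ∈ S.ReachM G h e a → ∃ P ∈ B.powerset.filter (fun P => S.GoodPat G h e a P), ω ∈ localCylinder (↑B : Set (Sym2 V)) ↑P := by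
    intro ω hω1 hω2 hωR
    refine ⟨B.filter (· ∈ ω), Finset.mem_filter.2 ⟨Finset.mem_powerset.2 (Finset.filter_subset _ _), ?_⟩, ?_⟩
    · -- `ξ ∪ (ω ∩ B)` agrees with `ω` on every pair inside `D`
      have hag : ∀ x ∈ wireSet (↑D : Set V), x ∈ ω ↔ x ∈ ((↑(S.ξ G h) : Set (Sym2 V)) ∪ ↑(B.filter (· ∈ ω))) := by
        intro x hxD
        by_cases hxE : x ∈ G.edgeSet
        · have hxbase : x ∈ S.baseF G h e a := by
            rw [baseF, mem_edgesIn_iff]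
            exact ⟨hxE, fun y hy => Finset.mem_coe.1 (hxD.1 y hy)⟩
          by_cases hxF : x ∈ S.F G h
          · have h1 := hω1 x (Finset.mem_coe.2 hxF)
            rw [Finset.mem_coe] at h1
            constructor
            · intro hxω; exact Or.inl (Finset.mem_coe.2 (h1.1 hxω))
            · rintro (h2 | h2)
              · exact h1.2 (Finset.mem_coe.1 h2)
              · exact (Finset.mem_filter.1 (Finset.mem_coe.1 h2)).2
          · constructor
            · intro hxω
              exact Or.inr (Finset.mem_coe.2 (Finset.mem_filter.2 ⟨Finset.mem_sdiff.2 ⟨hxbase, hxF⟩, hxω⟩))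
            · rintro (h2 | h2)
              · exact absurd (hV.ξ_sub (Finset.mem_coe.1 h2)) hxF
              · exact (Finset.mem_filter.1 (Finset.mem_coe.1 h2)).2
        · constructor
          · intro hxω; exact absurd hxω (hω2 x hxE)
          · rintro (h2 | h2)
            · exact absurd (hV.mem_edgeSet_of_mem_F (hV.ξ_sub (Finset.mem_coe.1 h2))) hxE
            · have := (Finset.mem_sdiff.1 (Finset.mem_filter.1 (Finset.mem_coe.1 h2)).1).1
              rw [baseF, mem_edgesIn_iff] at this
              exact absurd this.1 hxE
      have hdet := determinedBy_biUnion_openConnIn (↑D : Set V) S.Γ.root (↑(S.Γ.M a (tgt e)) : Set V) subset_rfl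
      rw [determinedBy_iff] at hdet
      unfold GoodPat ReachM
      refine (hdet ω _ ?_).1 hωR
      ext x
      simp only [Set.mem_inter_iff]
      constructor
      · rintro ⟨hxω, hxD⟩; exact ⟨(hag x hxD).1 hxω, hxD⟩
      · rintro ⟨hx, hxD⟩; exact ⟨(hag x hxD).2 hx, hxD⟩
    · intro x hx
      simp only [Finset.coe_filter, Set.mem_setOf_eq]
      exact ⟨fun h' => ⟨Finset.mem_coe.1 hx, h'⟩, fun h' => h'.2⟩
  have hcov : μ₀.real (S.ReachM G h e a) ≤ μ₀.real (⋃ P ∈ B.powerset.filter (fun P => S.GoodPat G h e a P),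
      localCylinder (↑B : Set (Sym2 V)) ↑P) := by
    set N : Set (BondConfig V) := {ω | ¬(ω ∈ localCylinder (↑(S.F G h) : Set (Sym2 V)) ↑(S.ξ G h) ∧
      ∀ x ∈ {x : Sym2 V | x ∉ G.edgeSet}, x ∉ ω)} with hN
    have hN0 : μ₀.real N = 0 := by
      rw [measureReal_eq_zero_iff]
      exact ae_iff.1 (by filter_upwards [hae1, hae2] with ω h1 h2; exact ⟨h1, h2⟩)
    have hsub : S.ReachM G h e a ⊆ (⋃ P ∈ B.powerset.filter (fun P => S.GoodPat G h e a P),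
        localCylinder (↑B : Set (Sym2 V)) ↑P) ∪ N := by
      intro ω hωR
      by_cases hω : ω ∈ N
      · exact Or.inr hω
      · simp only [hN, Set.mem_setOf_eq, not_not] at hω
        obtain ⟨P, hP, hωP⟩ := hkey ω hω.1 hω.2 hωR
        exact Or.inl (Set.mem_biUnion hP hωP)
    calc μ₀.real (S.ReachM G h e a) ≤ μ₀.real (⋃ P ∈ B.powerset.filter (fun P => S.GoodPat G h e a P),
          localCylinder (↑B : Set (Sym2 V)) ↑P) + μ₀.real N :=
          (measureReal_mono hsub (measure_ne_top _ _)).trans (measureReal_union_le _ _)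
      _ = _ := by rw [hN0, add_zero]
  refine hcov.trans ((measureReal_biUnion_finset_le _ _).trans (le_of_eq (Finset.sum_congr rfl fun P _ => ?_)))
  -- cylinders of fresh edges: `μ₀ = P_p` on `B`
  rw [← KNLevels.prodBernoulli_lattW]
  refine prodBernoulli_real_eq_of_determinedBy _ _ (fun x hx => ?_) (determinedBy_localCylinder _ _)
    (measurableSet_localCylinder B.finite_toSet.countable _)
  exact pinW_apply_of_not_mem _ _ (fun h' => (Finset.mem_sdiff.1 (Finset.mem_coe.1 hx)).2 (Finset.mem_coe.1 h'))

include hV hSt in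
/-- **The summed corridor bound (I1) of `fail_bound`**: if `1 - δ < P_{W₀}(root ↔ M_v)` ((32)) and for every good pattern `P` of the fresh edges
of `E_i ∪ E_{w,v}` Lemma 12 holds under `μ_{a'(P)}` pinned along `P` with loss `ε''` (`hcorr`), then `Σ_{a'} μ_{a'}(Reach_{a'}ᶜ ∩ Dev a') ≤ ε'' + δ`.
[cite: KozmaNitzan2024, §4 p. 30 (Step IV, first claim), p. 31 ((37))] -/
theorem sum_real_Reach_compl_inter_Dev_le {ε'' δ : ℝ} (hε'' : 0 ≤ ε'')
    (h32 : 1 - δ < (prodBernoulli (S.W₀ G h e a)).real (⋃ t ∈ S.Γ.M a (tgt e), openConn S.Γ.root t))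
    (hcorr : ∀ P ⊆ S.Bfr G h e a, S.GoodPat G h e a P →
      1 - ε'' < (prodBernoulli (pinW (S.Wfull G h e a (S.patAnchor G h e a P) du) ↑(S.Bfr G h e a) ↑P)).real
        (S.Reach G FD h e a (S.patAnchor G h e a P) du)) :
    ∑ a' ∈ S.Γ.anchSet a (tgt e), (prodBernoulli (S.Wfull G h e a a' du)).real ((S.Reach G FD h e a a' du)ᶜ ∩ S.Dev G h e a a') ≤
      ε'' + δ := by
  set B := S.Bfr G h e a with hB
  set T := S.Γ.anchSet a (tgt e) with hT
  set π : Finset (Sym2 V) → ℝ := fun P => (bondPercolation G S.p).real (localCylinder (↑B : Set (Sym2 V)) ↑P) with hπ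
  set gP : Finset (Sym2 V) → ℝ := fun P => if S.GoodPat G h e a P then ε'' else 1 with hgP
  have hRm : ∀ a', MeasurableSet (S.Reach G FD h e a a' du) := fun a' => measurableSet_biUnion_openConnIn _ _ _
  have hmem : ∀ P ∈ B.powerset, (↑P : Set (Sym2 V)) ∈ S.Dev G h e a (S.patAnchor G h e a P) := fun P hP =>
    localCylinder_subset_Dev (Finset.mem_powerset.1 hP) (fun x _ => Iff.rfl)
  -- per anchor: decompose over the patterns choosing it
  have hper : ∀ a' ∈ T, (prodBernoulli (S.Wfull G h e a a' du)).real ((S.Reach G FD h e a a' du)ᶜ ∩ S.Dev G h e a a') ≤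
      ∑ P ∈ B.powerset.filter (fun P => S.patAnchor G h e a P = a'), π P * gP P := by
    intro a' ha'
    rw [prodBernoulli_real_inter_eq_sum_pinW _ B (hRm a').compl (determinedBy_Dev h e a a')]
    have hfilt : B.powerset.filter (fun P : Finset (Sym2 V) => (↑P : Set (Sym2 V)) ∈ S.Dev G h e a a') =
        B.powerset.filter (fun P => S.patAnchor G h e a P = a') := by
      refine Finset.filter_congr fun P hP => ?_
      have h1 : S.depA G h e a (obs ↑P (S.env G h e a)) = S.patAnchor G h e a P :=
        depA_obs_eq_patAnchor (Finset.mem_powerset.1 hP) (fun x _ => Iff.rfl)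
      simp only [Dev, Set.mem_setOf_eq, h1]
    rw [hfilt]
    refine Finset.sum_le_sum fun P hP => ?_
    obtain ⟨hPB, hPa⟩ := Finset.mem_filter.1 hP
    rw [real_localCylinder_eq hSt ha' P]
    refine mul_le_mul_of_nonneg_left ?_ measureReal_nonneg
    by_cases hg : S.GoodPat G h e a P
    · rw [hgP]; simp only [hg, if_true]
      have h1 := hcorr P (Finset.mem_powerset.1 hPB) hg
      rw [hPa] at h1
      rw [measureReal_compl (hRm a'), probReal_univ]
      linarith
    · rw [hgP]; simp only [hg, if_false]; exact measureReal_le_one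
  -- collect the patterns
  have hcollect : ∑ a' ∈ T, ∑ P ∈ B.powerset.filter (fun P => S.patAnchor G h e a P = a'), π P * gP P =
      ∑ P ∈ B.powerset, π P * gP P :=
    Finset.sum_fiberwise_of_maps_to (fun P _ => S.Γ.anchor_mem _ _ _) _
  -- the bad patterns have mass `< δ`
  have hπsum : ∑ P ∈ B.powerset, π P = 1 := by
    have := prodBernoulli_real_eq_sum_localCylinder (KNLevels.lattW G S.p) B (determinedBy_univ (↑B : Set (Sym2 V)))
    rw [probReal_univ] at this
    rw [hπ, ← KNLevels.prodBernoulli_lattW, this]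
    exact (Finset.sum_congr (by ext P; simp) fun P _ => rfl).symm
  have hgood : 1 - δ < ∑ P ∈ B.powerset.filter (fun P => S.GoodPat G h e a P), π P :=
    h32.trans_le (real_W₀_le_sum_good hV)
  have hsplit : ∑ P ∈ B.powerset, π P * gP P =
      ε'' * ∑ P ∈ B.powerset.filter (fun P => S.GoodPat G h e a P), π P +
        ∑ P ∈ B.powerset.filter (fun P => ¬S.GoodPat G h e a P), π P := by
    rw [← Finset.sum_filter_add_sum_filter_not B.powerset (fun P => S.GoodPat G h e a P), Finset.mul_sum]
    congr 1
    · refine Finset.sum_congr rfl fun P hP => ?_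
      rw [hgP]; simp only [(Finset.mem_filter.1 hP).2, if_true]; ring
    · refine Finset.sum_congr rfl fun P hP => ?_
      rw [hgP]; simp only [(Finset.mem_filter.1 hP).2, if_false, mul_one]
  have hbad : ∑ P ∈ B.powerset.filter (fun P => ¬S.GoodPat G h e a P), π P =
      1 - ∑ P ∈ B.powerset.filter (fun P => S.GoodPat G h e a P), π P := by
    rw [← hπsum, ← Finset.sum_filter_add_sum_filter_not B.powerset (fun P => S.GoodPat G h e a P)]; ring
  have hgle : ∑ P ∈ B.powerset.filter (fun P => S.GoodPat G h e a P), π P ≤ 1 := by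
    rw [← hπsum]
    exact Finset.sum_le_sum_of_subset_of_nonneg (Finset.filter_subset _ _) fun P _ _ => measureReal_nonneg
  calc ∑ a' ∈ T, (prodBernoulli (S.Wfull G h e a a' du)).real ((S.Reach G FD h e a a' du)ᶜ ∩ S.Dev G h e a a')
      ≤ ∑ a' ∈ T, ∑ P ∈ B.powerset.filter (fun P => S.patAnchor G h e a P = a'), π P * gP P := Finset.sum_le_sum hper
    _ = ∑ P ∈ B.powerset, π P * gP P := hcollect
    _ ≤ ε'' + δ := by rw [hsplit, hbad]; nlinarith

end KSchA

end KNCells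

end Transplant

end Summit.CriticalPhenomena.PercolationContinuityZ3.Theorems

end
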